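import Mathlib
import HarnessLib
import HarnessLib.Audit
import Summits.SmoothPoincare4.Statement
import Literature.Topology.FourManifolds.ConnectedSum
import Literature.Topology.FourManifolds.ComplexProjectiveSpace
import Literature.Topology.FourManifolds.HomotopySpheres
import Literature.Topology.FourManifolds.Morse
import Literature.Topology.FourManifolds.RLinkSphere

/-!
Route: RootDecompY

DORMANT since 2026-09-04T16:54:02Z (reconciler: no traction for 5 d (last activity statement-closed at 2026-08-30T15:11:39Z); parked, not closed — `ledger route dormant route-SmoothPoincare4-RootDecompY --off` to reactivate) — unstaffed, not closed; items shared with open routes are served there. `ledger route dormant <id> --off` reactivates.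

# Route RootDecompY — SPC4 ⟺ two-step (possibly twisted) dissolution ∧ two-step-to-one-step descent
∧ ℂℙ²-cancellation at rank one — TwistedCarving (decomp-sp4 lens 6 gen 7)

X = TSD ∧ MD2 ∧ X₁ (root decomposition cell decomp-sp4, lens 6 «barrier-complement carving», gen 7,
node TwistedCarving — NEW
OR-sibling root node, advisory letter X (W = DivisorLadder born 07:13Z); kernel file
decomp-sp4-lens-6/v7/TwistedCarving.lean: `closes`, necessity
`twoStepDissolution_of_spc4` / `twoStepDescent_of_spc4` / `cp2CancellationOne_of_spc4`, exactness
`smoothPoincare4_iff_twistedCarving :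
SmoothPoincare4 ↔ TSD ∧ MD2 ∧ X₁`, and the exact carving of the registered attacked piece
DissolveOne #17710:
`dissolveOne_iff_tsd_and_md2 : DissolveOne ↔ TSD ∧ MD2`). TSD = `TwoStepDissolution` (NEW crux,
ATTACKED): every smooth homotopy
4-sphere M has P₁ = M # ℂℙ², P₂ = P₁ # ℂℙ² and a two-fold sum R of ℂℙ² with ℂℙ² (all sums
orientation-free, so R ∈ {2ℂℙ², ℂℙ²#ℂℙ²bar =
S²×~S², 2ℂℙ²bar}) with P₂ ≅ R — in particular the TWISTED stabilisation M # S²×~S² ≅ S²×~S²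
suffices. MD2 = `TwoStepDescent` (NEW crux):
two-step dissolution data ⟹ one-step dissolution M # ℂℙ² ≅ ℂℙ² (orientation-free) = the hypothesis
of X₁. X₁ = `CP2CancellationOne`
(POOLED, stmt-SmoothPoincare4-17708 verbatim; home DissolvableGluck, also RootDecompB/N): M # ℂℙ² ≅
ℂℙ² ⟹ M ≅ S⁴.
Lean: `Summit.SmoothPoincare4.SmoothPoincare4.Theses.RootDecompY.TwoStepDissolution ∧
Summit.SmoothPoincare4.SmoothPoincare4.Theses.RootDecompY.TwoStepDescent ∧
Summit.SmoothPoincare4.SmoothPoincare4.Theses.RootDecompY.CP2CancellationOne`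

## Assembly
Pure logic (route/glue.lean = kernel `TwistedCarving.closes`): given M with a homotopy equivalence e
to S⁴, TSD gives the two-step data,
MD2 turns it into a one-step dissolution, X₁ cancels — `exact h₃ M e (h₂ M e (h₁ M ⟨e⟩))`; all three
binders consumed (probes P10–P12:
no two of the three suffice cheaply). Exactness: `smoothPoincare4_iff_twistedCarving` (S → each
piece by `isConnectedSum_sphere_self_holds`,
`IsConnectedSum.of_diffeomorph_left`, `exists_isConnectedSum_holds`, all PROVED tree theorems), so
the node is an exact AND with no
EQUIV piece.

Rationale: WHY THIS LINE. Barrier A13 `OneStabilisationBarrier` (Kang 2022, arXiv:2210.07510) kills uniform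
«one S²×S² summand suffices» lemmas for contractible
pieces, and its recorded evasion is TWISTED stabilisation # S²×~S² = # ℂℙ² # ℂℙ²bar
(Hayden–Kang–Mukherjee arXiv:2304.01504 Lemma 3.1(b)
and Prop 3.3: Kang's pairs, exotic after one S²×S², are diffeomorphic after one S²×~S²); no node of
the forest A–V and no registered item
(#0386 StabOneSuffices uses S²×S², #24779/#17710 use definite ±ℂℙ² hosts) is typed on that evasion,
so this node puts the EXISTENCE
piece there: TSD is implied by DissolveOne #17710 (kernel `twoStepDissolution_of_dissolveOne`) and
by StabOne's twisted twin, and it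
is DECIDED TRUE on a strictly larger specimen population than any registered existence piece — on
all Gluck twists (Φ2: Σ_K # ℂℙ² ≅
ℂℙ², Gordon1976 Thm 4.6 / Melvin1977; S open there) AND on all 2-generator presentation spheres
(Φ4∣m=2, 407,873 census orbits incl.
the 15,575 Andrews–Curtis-residual ones where S, DissolveOne, DefiniteDissolution and MMSW Question
9.12 (arXiv:1910.08195 §9.3:
definite dissolution of D(P) at ANY rank) are open) by the TWISTED ONESTAB corollary proved in
NODE.md §3.2 (the census lemma
ONESTAB-Φ4 run with the spare 5-dimensional 2-handle twisted: N⁵(P) ♮ S²×~D³ ≅ S²×~D³, hence Σ(P) #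
S²×~S² ≅ S²×~S², by word moves,
1/2-cancellation and w₂ ≠ 0; Kirby1989 Cor 4.2). Imported areas: 5-dimensional handlebody theory /
Andrews–Curtis dictionary
(AndrewsCurtis1965, Wall), Kirby calculus of S²-bundles (Kirby1989 Ch. I §4), one-stabilisation
isotopy theory (AKMRS arXiv:1905.13532,
used by HKM). The recognition half is carved honestly: MD2 is EXACTLY DissolveOne restricted to
two-step-dissolvable spheres (kernel
`twoStepDescent_of_dissolveOne`, `dissolveOne_iff_tsd_and_md2`), on the twisted rows it is the
blow-down recognition of the image
(−1)-sphere ψ(Ē) ⊂ ℂℙ² # ℂℙ²bar = F₁ (homotopic to the exceptional curve E₀ by Hurewicz; isotopic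
iff a common square-0 dual with E₀
exists — Gabai's light bulb theorem arXiv:1705.09989 / Schneiderman–Teichner arXiv:1904.12350), and
X₁ stays the pooled summit-grade
residual shared with L/B/N. What prior routes / the negatives index do not do: no route stabilises
by the odd bundle; negatives index
empty.

Workshop record (writer decomp-sp4-writer-1 g3, cell decomp-sp4, rung 0): NODE HOME/STATUS.md line
341 (lens-6 g7, 2026-08-30T07:32:34Z; package HOME/decomp-sp4-lens-6/v7/, SHA256SUMS 31 files
verified by the writer, all OK); kernel decomp-sp4-lens-6/v7/TwistedCarving.lean sha256
201bd7a9bc2d58a542a8fe2f3a4bf1bde6acfbcc5f238a61721f3906dcafcdab (rc 0 · 0 errors · 0 warnings · 0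
sorry · axioms std); route package route/{Route.md, route.json, native_check.txt (verdict OK, 3/3
binders), tribunal_quick/full (tk=PROVISIONAL)}, split/{glue.lean, sig_*.txt, SigCheck.lean rc 0,
ledger_17708/17710/18065.json} adopted under the birth letter Y (package authored as X; V =
InvolutionCensus 07:02:29Z, W = DivisorLadder 07:13:04Z; letters are consumed in birth order — only
the `Summit.…Theses.RootDecomp<letter>.` prefixes of the Thesis/Assembly Lean lines change, bodies
are prefix-free); pooling verified by the writer against `ledger workitem get`: CP2CancellationOne
== #17708 signature BYTE-IDENTICAL (the ledger keys it to the existing item; no twin, no alias);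
filing choice X1 (new OR-sibling root) over X2 (split of DissolveOne #17710 inside P/L): the
critic’s disposition is followed — recorded below; census data HOME/census/COSTUME-CENSUS-v5.md
sha256 cb89ced12168b4f3fb419105fb427a97d0a3343f33794e090144449551229764. Critic verdict: critic
decomp-sp4-crit-1 g3 CLEARED HOME/STATUS.md line 346 2026-08-30T07:38:41Z (ledger row 76; both
filings admissible, no critic preference on the letter); per-piece critic tags are appended to each
item. Lineage route of record N rev 3 unchanged; the optional annex X3 (split of the residual into
DissolvableInvertible ∧ #18065) is NOT filed at birth.

RANKED CRUXES. #2 TwoStepDissolution (crux) — TSD (NEW, ATTACKED / INSTRUMENTABLE): for every smooth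
homotopy 4-sphere M there are smooth closed 4-manifolds P₁, P₂, R with IsConnectedSum M ℂℙ² P₁,
IsConnectedSum P₁ ℂℙ² P₂, IsConnectedSum ℂℙ² ℂℙ² R (tree relation, orientation-free: each sum is #
ℂℙ² or # ℂℙ²bar) and P₂ ≅ R; informally M # (±ℂℙ² # ±ℂℙ²) ≅ ±ℂℙ² # ±ℂℙ² for SOME signs, e.g. M #
S²×~S² ≅ S²×~S². [critic decomp-sp4-crit-1 g3 CLEARED HOME/STATUS.md line 346 2026-08-30T07:38:41Z
(ledger row 76; both filings admissible, no critic preference on the letter): TSD NEW crux r2 ·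
ATTACKED · WEAKER (⟸ S kernel + critic; ⟸ DissolveOne #17710 kernel L1; ⟸ DefiniteDissolution
#24779∣n=2 and ⟸ «M # S²×~S² ≅ S²×~S²» on paper; TSD ⇏ S / #17710 / MD2 probes FAIL 16/16) ·
GENUINE-P3 (decided TRUE on Φ2 — Gordon 1976 / Melvin — and on Φ4∣m=2 by the twisted ONESTAB
corollary NODE.md §3.2) · CAVEAT (critic 346): §3.2 is the lens’s own paper lemma, a referee target
not a citation · INSTRUMENTABLE · axis unused by A–X (odd rank-2 host S²×~S², evasion of A13) · BC7
CLEAN] [difficulty: open-problem] (why it might fail: A homotopy sphere resisting every rank-2 host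
of either parity (a closed analogue of Kang's two-stabilisation corks that is also ℂℙ²-rigid)
refutes it; decided only on Gluck twists, 2-generator presentation spheres and dissolution-certified
families.) [arXiv:2304.01504 Lemma 3.1(b) and Prop 3.3, arXiv:2210.07510, Kirby1989 Cor 4.2 and 4.6,
Gordon1976 Thm 4.6, Melvin1977, arXiv:1910.08195 Question 9.12, doi:10.1016/0040-9383(91)90036-4
p.102, stmt-SmoothPoincare4-17710, stmt-SmoothPoincare4-0386]
#3 TwoStepDescent (crux) — MD2 (NEW): for every smooth homotopy 4-sphere M with a homotopy
equivalence to S⁴, two-step dissolution data (P₁, P₂, R as in TSD with P₂ ≅ R) imply one-step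
dissolution: some connected sum P of M with ℂℙ² (orientation-free) is diffeomorphic to ℂℙ² — exactly
the hypothesis of CP2CancellationOne; MD2 = DissolveOne #17710 restricted to two-step-dissolvable
spheres (kernel), on twisted rows = blow-down recognition of the image exceptional sphere in ℂℙ² #
ℂℙ²bar. [critic decomp-sp4-crit-1 g3 CLEARED HOME/STATUS.md line 346 2026-08-30T07:38:41Z (ledger
row 76; both filings admissible, no critic preference on the letter): MD2 NEW crux r3 · WEAKER (⟸ S;
= #17710 restricted to the TSD-population, kernel + critic) · UNDECIDED (test T-COMMON-DUAL /
M10-F₁) · IDEA-NEEDED (blow-down recognition in F₁) · INSTRUMENTABLE · BC7 CLEAN] [difficulty: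
open-problem] (why it might fail: The (−1)-sphere ψ(Ē) ⊂ ℂℙ²#ℂℙ²bar from a twisted dissolution is
homotopic to the exceptional curve but need not be isotopic to it (no common square-0 dual known);
its blow-down M # ℂℙ² is standard iff DissolveOne holds on that row — open on Φ4∣m=2.)
[arXiv:1705.09989, arXiv:1904.12350, arXiv:1905.13532, Kirby1989 Thm 5.1, GompfStipsicz1999 §2.2,
arXiv:1910.08195 Question 9.12, stmt-SmoothPoincare4-17710]
#4 CP2CancellationOne (crux) — X₁ = stmt-SmoothPoincare4-17708 POOLED VERBATIM (home
DissolvableGluck; RootDecompB r201, RootDecompN r5): every smooth homotopy 4-sphere M admitting a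
connected sum P of M with ℂℙ² (orientation-free) diffeomorphic to ℂℙ² is diffeomorphic to S⁴;
summit-grade debt shared with L/B/N (X₁ ⟺ DIG ∧ GLUCK, DissolvableGluck's proved exact split).
[critic decomp-sp4-crit-1 g3 CLEARED HOME/STATUS.md line 346 2026-08-30T07:38:41Z (ledger row 76;
both filings admissible, no critic preference on the letter): X₁ POOLED VERBATIM ≡
stmt-SmoothPoincare4-17708 (byte-identical, writer-verified; three homes DissolvableGluck/B/N by rfl
per critic) · DECLARED RESIDUAL · barrier A7 head-on, Gluck-grade at least · counted once per
summit] [difficulty: open-problem] (why it might fail: X₁ = DIG ∧ GLUCK: the (+1)-sphere of a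
rank-one dissolution need not be standard (Melvin blow-down gives only «Gluck twist on some 2-knot»
if it is), and Gluck twists need not be standard (Kirby Problems 4.24/4.45 open; GNS
arXiv:2307.06388 Q5.6).) [GompfStipsicz1999, doi:10.1016/0040-9383(91)90036-4, arXiv:0907.0136,
Kirby1997, arXiv:2307.06388]

TWO-LAYER PLAN. Foreseen, NOT filed at birth: (a) X₁ ⟸ DissolvableInvertible ∧ InvertibleStandard
(DI NEW: ℂℙ²-dissolvable ⟹ S⁴ = M # M′, i.e. a
unit of the homotopy-sphere monoid; SCH = stmt-SmoothPoincare4-18065 of OneStabInvertible verbatim: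
units are standard), glue pure logic
(`TwistedCarving.cp2CancellationOne_of_invertible`; bodies split/sig_DissolvableInvertible.txt,
sig_InvertibleStandard.txt; SigCheck rc 0)
— the dissolution analogue of OneStabInvertible's StabCancellation ⟸ InvertibleOfOneStab ∧
InvertibleStandard; file only if the
critic wants the A7 × A14 carving of the residual. (b) MD2 ⟸ CommonDual (the image exceptional
sphere of a twisted dissolution shares a
square-0 dual with E₀) → light-bulb isotopy → blow-down, the IDEA-NEEDED line; (c) TSD∣family
support items as provers certify rows
(Φ4∣m=2 twisted ONESTAB as a Literature/Theorems paper lemma first).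

KILL CRITERIA. TSD is refuted (and with it S) by ONE homotopy sphere M with M # S²×~S² ≇ S²×~S², M #
2ℂℙ² ≇ 2ℂℙ² and M # 2ℂℙ²bar ≇ 2ℂℙ²bar; MD2 by a
two-step-dissolvable M with M # ℂℙ² ≇ ℂℙ² and M # ℂℙ²bar ≇ ℂℙ²bar (refutes DissolveOne #17710 and
S); X₁ by an exotic ℂℙ²-dissolvable
sphere (refutes S; shared with L/B/N). The ROUTE is retired as idle (not S) if TSD is proved
outright for all homotopy spheres by a
uniform argument that also gives MD2 (then the node collapses to X₁ = L's residual), or if MD2 is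
shown kernel-equivalent to
DissolveOne by a cheap argument independent of TSD (then TSD is decoration) — today DissolveOne →
MD2 is trivial but MD2 → DissolveOne
FAILS (probe P5) and TSD → DissolveOne FAILS (P4).

NOT DECOMPOSED YET. TSD by specimen family (Φ2, Φ4∣m=2, Φ4∣m≥3, HKM branched covers, CS pictures) —
rows are support lemmas for provers, not items (two
layers only); the annex DI ∧ SCH under X₁ (Two-layer plan (a)); MD2's common-dual reformulation
(idea card first). The general-m twisted
statement Σ(P) # S²×~S² # (m−2)(S²×S²) ≅ S²×~S² # (m−2)(S²×S²) (NODE.md §3.2, Kirby1989 Cor 4.6) is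
recorded but is not TSD for m ≥ 3.

CHEAPEST FALSIFIER. T-TWIST-Φ4 (desk, 0 core-h, done in NODE.md §3.2): the twisted ONESTAB corollary
— if the critic finds a gap (e.g. a framing
dependence in Steps 1–3 of ONESTAB-Φ4) TSD loses its new decided family and the node degrades to a
costume of DissolveOne ∨ StabOne;
the proof was checked move by move (1/2-cancellation and word moves are framing-blind; w₂ ≠ 0 forces
the surviving bundle to be
twisted). Next cheapest (kit, ≤ 5 core-h, census seat): T-COMMON-DUAL — for 20 AC-residual
2-generator presentations, run the
constructive twisted certificate (remark (a) of ONESTAB-Φ4 with a coset-enumeration certificate),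
track the fibre sphere F of the
spare S²×~D³ through the moves and test by handle slides whether ψ(F) is isotopic to a fibre of F₁
meeting E₀ once; one success
decides DissolveOne on that row (light bulb theorem, π₁ = 1), a uniform failure pattern is the MD2
obstruction to name.

NUMBERS. Specimen ledger (census v5): Φ4∣m=2: 407,873 trivial-group 2-generator orbits at relator
length ≤ 18, 15,575 AC-residual (S open),
all TSD-decided by §3.2; Φ2: all Gluck twists TSD-decided (Gordon Thm 4.6), S open for general K;
Φ4∣m=3: 917/917 census presentations
two-stably standard (ONESTAB), TSD open there. Ranks: TSD = rank-2 host of any type (b₂ = 2: 2ℂℙ²,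
S²×~S², 2ℂℙ²bar — all inside
SmallExoticaBarrier's open zone b₂ ≤ 2); #0386 = rank-2 even host S²×S²; #17710 = rank 1; #24779 =
definite rank n.

DEFINITION REQUESTS. None: all statements are over
`Literature.Topology.FourManifolds.IsConnectedSum` / `ComplexProjectivePlane` / `Diffeomorph`; the
twisted bundle S²×~S² is never named (it is «a connected sum of ℂℙ² with ℂℙ²» in the
orientation-free relation, Kirby1989 Cor 4.2).
Cite facts wanted later (Literature, proved in print): Kirby1989 Cor 4.2/4.3/4.6; HKM 2023 Lemma
3.1; Gabai LBT Thm 1.2; the census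
paper lemma ONESTAB-Φ4 and its twisted corollary as `Summits/…/Theorems` paper-lemma stubs.

Novelty: Searches (2026-08-30): rg over Summits/SmoothPoincare4/SmoothPoincare4/Theses for
`S²×~S²|twisted|ℂℙ²bar|CP2bar` → only
orientation remarks, no item stabilises by the odd bundle or by a mixed-sign pair; TREE.md v6 nodes
A–V: none; `ledger negatives
--problem SmoothPoincare4` → 0 statements; BC4 `exact?` fails 16/16 (bc/probes_exact.lean). Corpus:
`lit search --hybrid "twisted
stabilization S2 tilde S2 one stabilization enough"` → [corpus:paper:arxiv-2304.01504 p.3 L22–45,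
p.5 L49–56] (HKM Lemma 3.1(b),
Prop 3.3), [corpus:book:kirby1989-topology-4-manifolds p.11 Cor 4.2/4.3/4.6]; `lit read
arxiv:1910.08195 --grep "Question 9.1"` →
[corpus:paper:arxiv-1910.08195 p.30 L22–35] (MMSW Q9.11/9.12: definite dissolution of D(P) open);
[corpus:paper:gompf1991-killing
p.102 Remark] (H_{n,k} # ℂℙ²bar collapses); galaxy `"twisted stabilization|twisted stabilisation"
--star all` → 0 rows, `"Gluck
twist|one stabilization" --star pdf` → noise only (null recorded). Nearest prior art found: HKM 2023
(twisted stabilisation as the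
evasion of Kang's barrier, for disc exteriors/corks, not homotopy spheres); census lemma ONESTAB-Φ4
(untwisted, m−1 stabilisations);
Stabilisation #0386 / DissolvableGluck #17710 / RootDecompB #24779 (even / rank-1 / definite hosts).
Delta: the existence half of SPC4's
dissolution programme typed on the odd rank-2 host, where it is decided on Φ2 ∪ Φ4∣m=2 (a population
on which no registered existence
piece is decided), with the exact carving DissolveOne ⟺ TSD ∧ MD2 pro  [refs: 1910.08195, 2304.01504, paper:arxiv-2304.01504, book:kirby1989-topology-4-manifolds, arxiv:1910.08195, paper:arxiv-1910.08195, paper:gompf1991-killing]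

Barriers (technique_class: twisted-stabilisation, blow-down, 5-dim-handlebody, gluck): - technique_class: twisted-stabilisation, blow-down, 5-dim-handlebody, gluck
- Literature.Barriers.SmoothPoincare4.OneStabilisationBarrier: outside BY CONSTRUCTION — the barrier
quantifies over one S²×S² (even, spin) summand for contractible pieces (Kang Cor 1.2); TSD's host is
the ODD bundle S²×~S² = ℂℙ²#ℂℙ²bar or a definite pair, exactly the recorded evasion (HKM 2023 Lemma
3.1(b)/Prop 3.3: Kang's pairs become diffeomorphic after one S²×~S²); for homotopy spheres the
barrier's own Escape says S1 is untouched.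
- Literature.Barriers.SmoothPoincare4.GluckTwistCP2Barrier: consistent and load-bearing only for the
residual — TSD/MD2 assert dissolution (the barrier's mechanism), never detection by a
ℂℙ²-cancellative invariant; X₁ (pooled) is where the Gluck twist conjecture sits, declared
summit-grade debt as in L/B/N, not attacked here.
- Literature.Barriers.SmoothPoincare4.GaugeSumBarrierFour: consistent — no SW/Donaldson/BF invariant
is asked to see M; indeed M # F₁ has the invariants of F₁, which is why MD2 is tagged IDEA-NEEDED
(constructive isotopy / light bulb), not invariant-driven.
- Literature.Barriers.SmoothPoincare4.StableBarrierFour: consistent — TSD is a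
ONE-(twisted-)stabilisation existence statement, finer than the stable class; no stable invariant is
used to detect anything.
- Literature.Barriers.SmoothPoincare4.SmallExoticaBarrier: inside its Escape — every host has b₂ ≤ 2
(2ℂℙ², ℂℙ²#ℂℙ²bar, 2ℂℙ²bar), the zone the barrier declares open; no type-blind b₂-graded ri

History (route lifecycle, newest last):
- 2026-08-31T02:28:00Z · RESIDUAL declared: DefiniteTwoStepDescent (stmt-SmoothPoincare4-31190) — summit-strength until shown otherwise: g18 schema migration (D-0170): tribunal residual of record (stmt-SmoothPoincare4-31190, route tribunal.residual; TREE-IN (planner-decomp-sp4-writer-1-g18-0)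
- 2026-08-31T02:28:00Z · RESIDUAL declared: NoOneHandlesExist (stmt-SmoothPoincare4-0378) — summit-strength until shown otherwise: g18 schema migration (D-0170): tribunal residual of record (stmt-SmoothPoincare4-0378, route tribunal.residual; TREE-IND (planner-decomp-sp4-writer-1-g18-0)
- 2026-08-31T02:28:02Z · RESIDUAL declared: GscCP2Cancellation (stmt-SmoothPoincare4-32280) — summit-strength until shown otherwise: g18 schema migration (D-0170): tribunal residual of record (stmt-SmoothPoincare4-32280, route tribunal.residual; TREE-IN (planner-decomp-sp4-writer-1-g18-0)
- 2026-09-04T16:54:02Z · DORMANT — reconciler: no traction for 5 d (last activity statement-closed at 2026-08-30T15:11:39Z); parked, not closed — `ledger route dormant route-SmoothPoincare4-RootD (operator:999:1102732)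

sub-problem: SmoothPoincare4 · status: dormant · opened planner-decomp-sp4-writer-1-g3-0 2026-08-30T07:46:31Z · rev 2 · ledger route-SmoothPoincare4-RootDecompY
GENERATED by the gate from the ledger (D-0016/17). Provers cite these decls: `theorem foo : Summit.SmoothPoincare4.SmoothPoincare4.Theses.RootDecompY.<Decl> := …` in Summits/SmoothPoincare4/SmoothPoincare4/Theorems/<Name>.lean.
-/

namespace Summit.SmoothPoincare4.SmoothPoincare4.Theses.RootDecompY

open scoped BigOperators Topology Manifold Classical MeasureTheory ProbabilityTheory Matrix InnerProductSpace ComplexConjugate ContinuousMap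
open Filter Set Function TopologicalSpace MeasureTheory

attribute [summit_statement] _root_.SmoothPoincare4

open Literature.SPC4

/-- item stmt-SmoothPoincare4-30441 · crux · leaf INSTRUMENTABLE · rank 2 · open · by planner
why it might fail: A homotopy sphere resisting every rank-2 host of either parity (a closed analogue of Kang's two-stabilisation corks that is also ℂℙ²-rigid) refutes it; decided only on Gluck twists, 2-generator presentation spheres and dissolution-certified families.
sources: arXiv:2304.01504 Lemma 3.1(b) and Prop 3.3, arXiv:2210.07510, Kirby1989 Cor 4.2 and 4.6, Gordon1976 Thm 4.6, Melvin1977, arXiv:1910.08195 Question 9.12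
[crux] TSD (NEW, ATTACKED / INSTRUMENTABLE): for every smooth homotopy 4-sphere M there are smooth
closed 4-manifolds P₁, P₂, R with IsConnectedSum M ℂℙ² P₁, IsConnectedSum P₁ ℂℙ² P₂, IsConnectedSum
ℂℙ² ℂℙ² R (tree relation, orientation-free: each sum is # ℂℙ² or # ℂℙ²bar) and P₂ ≅ R; informally M
# (±ℂℙ² # ±ℂℙ²) ≅ ±ℂℙ² # ±ℂℙ² for SOME signs, e.g. M # S²×~S² ≅ S²×~S². [critic decomp-sp4-crit-1 g3
CLEARED HOME/STATUS.md line 346 2026-08-30T07:38:41Z (ledger row 76; both filings admissible, no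
critic preference on the letter): TSD NEW crux r2 · ATTACKED · WEAKER (⟸ S kernel + critic; ⟸
DissolveOne #17710 kernel L1; ⟸ DefiniteDissolution #24779∣n=2 and ⟸ «M # S²×~S² ≅ S²×~S²» on paper;
TSD ⇏ S / #17710 / MD2 probes FAIL 16/16) · GENUINE-P3 (decided TRUE on Φ2 — Gordon 1976 / Melvin —
and on Φ4∣m=2 by the twisted ONESTAB corollary NODE.md §3.2) · CAVEAT (critic 346): §3.2 is the
lens’s own paper lemma, a referee target not a citation · INSTRUMENTABLE · axis unused by A–X (odd
rank-2 host S²×~S², evasion of A13) · BC7 CLEAN] [difficulty: open-problem] -/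
@[route_item "route-SmoothPoincare4-RootDecompY"]
def TwoStepDissolution : Prop :=
  open scoped ContDiff in ∀ (M : Type) [TopologicalSpace M] [T2Space M] [SecondCountableTopology M] [ChartedSpace (EuclideanSpace ℝ (Fin 4)) M] [IsManifold (𝓡 4) ∞ M], Nonempty (ContinuousMap.HomotopyEquiv M (Metric.sphere (0 : EuclideanSpace ℝ (Fin 5)) 1)) → ∃ (P₁ P₂ R : Type) (_ : TopologicalSpace P₁) (_ : T2Space P₁) (_ : SecondCountableTopology P₁) (_ : ChartedSpace (EuclideanSpace ℝ (Fin 4)) P₁) (_ : IsManifold (𝓡 4) ∞ P₁) (_ : TopologicalSpace P₂) (_ : T2Space P₂) (_ : SecondCountableTopology P₂) (_ : ChartedSpace (EuclideanSpace ℝ (Fin 4)) P₂) (_ : IsManifold (𝓡 4) ∞ P₂) (_ : TopologicalSpace R) (_ : T2Space R) (_ : SecondCountableTopology R) (_ : ChartedSpace (EuclideanSpace ℝ (Fin 4)) R) (_ : IsManifold (𝓡 4) ∞ R), Literature.Topology.FourManifolds.IsConnectedSum (𝓡 4) (𝓡 4) (𝓡 4) M Literature.Topology.FourManifolds.ComplexProjectivePlane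 P₁ ∧ Literature.Topology.FourManifolds.IsConnectedSum (𝓡 4) (𝓡 4) (𝓡 4) P₁ Literature.Topology.FourManifolds.ComplexProjectivePlane P₂ ∧ Literature.Topology.FourManifolds.IsConnectedSum (𝓡 4) (𝓡 4) (𝓡 4) Literature.Topology.FourManifolds.ComplexProjectivePlane Literature.Topology.FourManifolds.ComplexProjectivePlane R ∧ Nonempty (P₂ ≃ₘ⟮𝓡 4, 𝓡 4⟯ R)

/-- item stmt-SmoothPoincare4-30442 · crux · rank 3 · SPLIT (gen 1) into TwistedDescent, DefiniteTwoStepDescent + glue TwoStepDescentParityGlue · direct attempts still welcome (low priority) · by planner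
why it might fail: The (−1)-sphere ψ(Ē) ⊂ ℂℙ²#ℂℙ²bar from a twisted dissolution is homotopic to the exceptional curve but need not be isotopic to it (no common square-0 dual known); its blow-down M # ℂℙ² is standard iff DissolveOne holds on that row — open on Φ4∣m=2.
sources: arXiv:1705.09989, arXiv:1904.12350, arXiv:1905.13532, Kirby1989 Thm 5.1, GompfStipsicz1999 §2.2, arXiv:1910.08195 Question 9.12
[crux] MD2 (NEW): for every smooth homotopy 4-sphere M with a homotopy equivalence to S⁴, two-step
dissolution data (P₁, P₂, R as in TSD with P₂ ≅ R) imply one-step dissolution: some connected sum P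
of M with ℂℙ² (orientation-free) is diffeomorphic to ℂℙ² — exactly the hypothesis of
CP2CancellationOne; MD2 = DissolveOne #17710 restricted to two-step-dissolvable spheres (kernel), on
twisted rows = blow-down recognition of the image exceptional sphere in ℂℙ² # ℂℙ²bar. [critic
decomp-sp4-crit-1 g3 CLEARED HOME/STATUS.md line 346 2026-08-30T07:38:41Z (ledger row 76; both
filings admissible, no critic preference on the letter): MD2 NEW crux r3 · WEAKER (⟸ S; = #17710
restricted to the TSD-population, kernel + critic) · UNDECIDED (test T-COMMON-DUAL / M10-F₁) ·
IDEA-NEEDED (blow-down recognition in F₁) · INSTRUMENTABLE · BC7 CLEAN] [difficulty: open-problem] -/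
@[route_item "route-SmoothPoincare4-RootDecompY"]
def TwoStepDescent : Prop :=
  open scoped ContDiff in ∀ (M : Type) [TopologicalSpace M] [T2Space M] [SecondCountableTopology M] [ChartedSpace (EuclideanSpace ℝ (Fin 4)) M] [IsManifold (𝓡 4) ∞ M], ContinuousMap.HomotopyEquiv M (Metric.sphere (0 : EuclideanSpace ℝ (Fin 5)) 1) → (∃ (P₁ P₂ R : Type) (_ : TopologicalSpace P₁) (_ : T2Space P₁) (_ : SecondCountableTopology P₁) (_ : ChartedSpace (EuclideanSpace ℝ (Fin 4)) P₁) (_ : IsManifold (𝓡 4) ∞ P₁) (_ : TopologicalSpace P₂) (_ : T2Space P₂) (_ : SecondCountableTopology P₂) (_ : ChartedSpace (EuclideanSpace ℝ (Fin 4)) P₂) (_ : IsManifold (𝓡 4) ∞ P₂) (_ : TopologicalSpace R) (_ : T2Space R) (_ : SecondCountableTopology R) (_ : ChartedSpace (EuclideanSpace ℝ (Fin 4)) R) (_ : IsManifold (𝓡 4) ∞ R), Literature.Topology.FourManifolds.IsConnectedSum (𝓡 4) (𝓡 4) (𝓡 4) M Literature.Topology.FourManifolds.ComplexProjectivePlane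 P₁ ∧ Literature.Topology.FourManifolds.IsConnectedSum (𝓡 4) (𝓡 4) (𝓡 4) P₁ Literature.Topology.FourManifolds.ComplexProjectivePlane P₂ ∧ Literature.Topology.FourManifolds.IsConnectedSum (𝓡 4) (𝓡 4) (𝓡 4) Literature.Topology.FourManifolds.ComplexProjectivePlane Literature.Topology.FourManifolds.ComplexProjectivePlane R ∧ Nonempty (P₂ ≃ₘ⟮𝓡 4, 𝓡 4⟯ R)) → ∃ (P : Type) (_ : TopologicalSpace P) (_ : T2Space P) (_ : SecondCountableTopology P) (_ : ChartedSpace (EuclideanSpace ℝ (Fin 4)) P) (_ : IsManifold (𝓡 4) ∞ P), Literature.Topology.FourManifolds.IsConnectedSum (𝓡 4) (𝓡 4) (𝓡 4) M Literature.Topology.FourManifolds.ComplexProjectivePlane P ∧ Nonempty (P ≃ₘ⟮𝓡 4, 𝓡 4⟯ Literature.Topology.FourManifolds.ComplexProjectivePlane)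

-- parent: TwoStepDescent · child (gen 1)
/--     item stmt-SmoothPoincare4-31189 · crux · rank 301 · open
    parent: TwoStepDescent · by planner
    why it might fail: Implied by S, implies nothing known; its one instrument (Gabai LBT Thm 1.2 on φ(E_M), E₀ ⊂ ℂℙ²#ℂℙ²bar) needs a COMMON transverse sphere (idea CDA, open); an exotic homotopy ℂℙ² N with N#ℂℙ²bar ≅ ℂℙ²#ℂℙ²bar refutes it.
    sources: arXiv:1705.09989, Kirby1989, arXiv:2304.01504, arXiv:1910.08195
[crux] TWISTED (odd-host) half of TwoStepDescent #30442: for every smooth homotopy 4-sphere M (e : M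
≃ S⁴), if M#ℂℙ² =: P₁, P₁#ℂℙ² =: P₂ and P₂ ≅ R where R is an ORIENTED connected sum (ℂℙ²,c)#(ℂℙ²,−c)
(so R ≅ ℂℙ²#ℂℙ²bar ≅ S²×~S², the odd indefinite rank-2 host), then M#ℂℙ² ≅ ℂℙ² (∃ P, IsConnectedSum
M ℂℙ² P ∧ P ≅ ℂℙ²). Why it might fail: it is implied by S and implies nothing known; the only
instrument (Gabai LBT Thm 1.2, arXiv:1705.09989 p.3, applied to the exceptional sphere φ(E_M) and E₀
in ℂℙ²#ℂℙ²bar, both with square-0 duals) needs a COMMON transverse sphere (idea CDA, open); an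
exotic homotopy ℂℙ² N with N#ℂℙ²bar ≅ ℂℙ²#ℂℙ²bar would refute it. Sources: arXiv:1705.09989 Thm
1.2/§10; Kirby1989 Cor 4.2; arXiv:2304.01504 p.3,5; lens-6 v8 NODE §3/§7. [critic decomp-sp4-crit-1
g3 CLEARED HOME/STATUS.md line 730 2026-08-30T08:35:31Z (ledger row 87): TD NEW crux r301 · ATTACKED
child of the parity split · WEAKER (probes_exact 16/16 fail, battery 16/16 fail; decided pointwise
exactly where RankOne is) · ATTACKED-VIA Gabai light-bulb Thm 1.2 [corpus:paper:arxiv-1705.09989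
p.3] in R = S²×~S² (exceptional classes ±e, square-0 duals h ∓ e; a COMMON transverse sphere for
φ(Ē_M) and E₀ give -/
@[route_item "route-SmoothPoincare4-RootDecompY"]
def TwistedDescent : Prop :=
  open scoped ContDiff in ∀ (M : Type) [TopologicalSpace M] [T2Space M] [SecondCountableTopology M] [ChartedSpace (EuclideanSpace ℝ (Fin 4)) M] [IsManifold (𝓡 4) ∞ M], ContinuousMap.HomotopyEquiv M (Metric.sphere (0 : EuclideanSpace ℝ (Fin 5)) 1) → (∃ (P₁ P₂ R : Type) (_ : TopologicalSpace P₁) (_ : T2Space P₁) (_ : SecondCountableTopology P₁) (_ : ChartedSpace (EuclideanSpace ℝ (Fin 4)) P₁) (_ : IsManifold (𝓡 4) ∞ P₁) (_ : TopologicalSpace P₂) (_ : T2Space P₂) (_ : SecondCountableTopology P₂) (_ : ChartedSpace (EuclideanSpace ℝ (Fin 4)) P₂) (_ : IsManifold (𝓡 4) ∞ P₂) (_ : TopologicalSpace R) (_ : T2Space R) (_ : SecondCountableTopology R) (_ : ChartedSpace (EuclideanSpace ℝ (Fin 4)) R) (_ : IsManifold (𝓡 4) ∞ R), Literature.Topology.FourManifolds.IsConnectedSum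 (𝓡 4) (𝓡 4) (𝓡 4) M Literature.Topology.FourManifolds.ComplexProjectivePlane P₁ ∧ Literature.Topology.FourManifolds.IsConnectedSum (𝓡 4) (𝓡 4) (𝓡 4) P₁ Literature.Topology.FourManifolds.ComplexProjectivePlane P₂ ∧ (∃ (c : Literature.Topology.FourManifolds.SmoothOrientation (𝓡 4) Literature.Topology.FourManifolds.ComplexProjectivePlane) (oR : Literature.Topology.FourManifolds.SmoothOrientation (𝓡 4) R), Literature.Topology.FourManifolds.IsOrientedConnectedSum c (-c) oR) ∧ Nonempty (P₂ ≃ₘ⟮𝓡 4, 𝓡 4⟯ R)) → ∃ (P : Type) (_ : TopologicalSpace P) (_ : T2Space P) (_ : SecondCountableTopology P) (_ : ChartedSpace (EuclideanSpace ℝ (Fin 4)) P) (_ : IsManifold (𝓡 4) ∞ P), Literature.Topology.FourManifolds.IsConnectedSum (𝓡 4) (𝓡 4) (𝓡 4) M Literature.Topology.FourManifolds.ComplexProjectivePlane P ∧ Nonempty (P ≃ₘ⟮𝓡 4, 𝓡 4⟯ Literature.Topology.FourManifolds.ComplexProjectivePlane)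

-- parent: TwoStepDescent · child (gen 1)
/--     item stmt-SmoothPoincare4-31190 · crux · RESIDUAL (gen 0; summit-strength until shown otherwise, D-0170) · rank 302 · open
    parent: TwoStepDescent · by planner
    why it might fail: ⟨1⟩⊕⟨1⟩ has no isotropic vector: no sphere in 2ℂℙ² has a transverse sphere, every light-bulb instrument is void; = n=2 slice of DefiniteDescent #26487 on paper (open); an exotic homotopy ℂℙ² N with N#ℂℙ² ≅ 2ℂℙ² refutes it.
    sources: arXiv:1705.09989, stmt:SmoothPoincare4-26487, arXiv:1910.08195
[crux; DECLARED RESIDUAL of the split] DEFINITE half of TwoStepDescent #30442: same data with R an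
oriented connected sum (ℂℙ²,c)#(ℂℙ²,c) (R ≅ 2ℂℙ², positive definite rank-2 host) ⟹ M#ℂℙ² ≅ ℂℙ². Why
it might fail: H₂(2ℂℙ²)=⟨1⟩⊕⟨1⟩ has no isotropic vector, so NO embedded sphere in the host has a
transverse sphere and every light-bulb / common-dual instrument is void; on paper it is the n=2
slice of RootDecompB.DefiniteDescent #26487 (open) and is dominated by it; an exotic homotopy ℂℙ² N
with N#ℂℙ² ≅ 2ℂℙ² refutes it. Sources: arXiv:1705.09989 Def 2.1 (transverse sphere needs trivial
normal bundle); #26487; lens-6 v8 NODE §3/§5. [critic decomp-sp4-crit-1 g3 CLEARED HOME/STATUS.md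
line 730 2026-08-30T08:35:31Z (ledger row 87): D2D NEW crux r302 · DECLARED RESIDUAL of the split ·
WEAKER · dominated ON PAPER by the pooled open B.DefiniteDescent #26487 at n = 2 (not a Lean
implication today; test: prove D2D ⟸ #26487|n=2 once HasSignature additivity is in the closure) ·
instrument VOID by construction (⟨1⟩⊕⟨1⟩ has no isotropic vector ⟹ no transverse sphere) — honest ·
BC7 CLEAN] -/
@[route_item "route-SmoothPoincare4-RootDecompY"]
def DefiniteTwoStepDescent : Prop :=
  open scoped ContDiff in ∀ (M : Type) [TopologicalSpace M] [T2Space M] [SecondCountableTopology M] [ChartedSpace (EuclideanSpace ℝ (Fin 4)) M] [IsManifold (𝓡 4) ∞ M], ContinuousMap.HomotopyEquiv M (Metric.sphere (0 : EuclideanSpace ℝ (Fin 5)) 1) → (∃ (P₁ P₂ R : Type) (_ : TopologicalSpace P₁) (_ : T2Space P₁) (_ : SecondCountableTopology P₁) (_ : ChartedSpace (EuclideanSpace ℝ (Fin 4)) P₁) (_ : IsManifold (𝓡 4) ∞ P₁) (_ : TopologicalSpace P₂) (_ : T2Space P₂) (_ : SecondCountableTopology P₂) (_ : ChartedSpace (EuclideanSpace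 ℝ (Fin 4)) P₂) (_ : IsManifold (𝓡 4) ∞ P₂) (_ : TopologicalSpace R) (_ : T2Space R) (_ : SecondCountableTopology R) (_ : ChartedSpace (EuclideanSpace ℝ (Fin 4)) R) (_ : IsManifold (𝓡 4) ∞ R), Literature.Topology.FourManifolds.IsConnectedSum (𝓡 4) (𝓡 4) (𝓡 4) M Literature.Topology.FourManifolds.ComplexProjectivePlane P₁ ∧ Literature.Topology.FourManifolds.IsConnectedSum (𝓡 4) (𝓡 4) (𝓡 4) P₁ Literature.Topology.FourManifolds.ComplexProjectivePlane P₂ ∧ (∃ (c : Literature.Topology.FourManifolds.SmoothOrientation (𝓡 4) Literature.Topology.FourManifolds.ComplexProjectivePlane) (oR : Literature.Topology.FourManifolds.SmoothOrientation (𝓡 4) R), Literature.Topology.FourManifolds.IsOrientedConnectedSum c c oR) ∧ Nonempty (P₂ ≃ₘ⟮𝓡 4, 𝓡 4⟯ R)) → ∃ (P : Type) (_ : TopologicalSpace P) (_ : T2Space P) (_ : SecondCountableTopology P) (_ : ChartedSpace (EuclideanSpace ℝ (Fin 4)) P) (_ : IsManifold (𝓡 4) ∞ P), Literature.Topology.FourManifolds.IsConnectedSum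 (𝓡 4) (𝓡 4) (𝓡 4) M Literature.Topology.FourManifolds.ComplexProjectivePlane P ∧ Nonempty (P ≃ₘ⟮𝓡 4, 𝓡 4⟯ Literature.Topology.FourManifolds.ComplexProjectivePlane)

-- parent: TwoStepDescent · glue (gen 1)
/--     item stmt-SmoothPoincare4-31191 · support · rank 303 · closed · proved by Summit.SmoothPoincare4.SmoothPoincare4.Theorems.RootDecompYTwoStepDescentParitySplit.twoStepDescentParityGlue_holds (prover)
    parent: TwoStepDescent · GLUE: children ⟹ parent · by planner
TwistedDescent → DefiniteTwoStepDescent → TwoStepDescent -/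
@[route_item "route-SmoothPoincare4-RootDecompY"]
def TwoStepDescentParityGlue : Prop :=
  TwistedDescent → DefiniteTwoStepDescent → TwoStepDescent

-- `TwoStepDescentParityGlue` holds: proved by `Summit.SmoothPoincare4.SmoothPoincare4.Theorems.RootDecompYTwoStepDescentParitySplit.twoStepDescentParityGlue_holds` (its module imports this route file, so no `_holds` link can be stated here).

/-- item stmt-SmoothPoincare4-17708 · crux · rank 4 · SPLIT (gen 1) into NoOneHandlesExist, MorseGscIsRLinkSphere, GscCP2Cancellation + glue CP2CancellationOneGscGlue · direct attempts still welcome (low priority) · by planner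
why it might fail: X₁ = DIG ∧ GLUCK: the (+1)-sphere of a rank-one dissolution need not be standard (Melvin blow-down gives only «Gluck twist on some 2-knot» if it is), and Gluck twists need not be standard (Kirby Problems 4.24/4.45 open; GNS arXiv:2307.06388 Q5.6).
sources: GompfStipsicz1999, doi:10.1016/0040-9383(91)90036-4, arXiv:0907.0136, Kirby1997, arXiv:2307.06388
[target] X₁ — every smooth homotopy 4-sphere M admitting a connected sum P of M with ℂℙ² that is
diffeomorphic to ℂℙ² is diffeomorphic to S⁴ (TwistorDissolution's CP2Cancellation at n = 1, one sum
instead of a chain; the tree's IsConnectedSum is orientation-free, so both M # ℂℙ² and M # ℂℙ²bar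
readings are included). -/
@[route_item "route-SmoothPoincare4-RootDecompY"]
def CP2CancellationOne : Prop :=
  open scoped ContDiff in ∀ (M : Type) [TopologicalSpace M] [T2Space M] [SecondCountableTopology M] [ChartedSpace (EuclideanSpace ℝ (Fin 4)) M] [IsManifold (𝓡 4) ∞ M], ContinuousMap.HomotopyEquiv M (Metric.sphere (0 : EuclideanSpace ℝ (Fin 5)) 1) → (∃ (P : Type) (_ : TopologicalSpace P) (_ : T2Space P) (_ : SecondCountableTopology P) (_ : ChartedSpace (EuclideanSpace ℝ (Fin 4)) P) (_ : IsManifold (𝓡 4) ∞ P), Literature.Topology.FourManifolds.IsConnectedSum (𝓡 4) (𝓡 4) (𝓡 4) M Literature.Topology.FourManifolds.ComplexProjectivePlane P ∧ Nonempty (P ≃ₘ⟮𝓡 4, 𝓡 4⟯ Literature.Topology.FourManifolds.ComplexProjectivePlane)) → Nonempty (M ≃ₘ⟮𝓡 4, 𝓡 4⟯ Metric.sphere (0 : EuclideanSpace ℝ (Fin 5)) 1)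

-- parent: CP2CancellationOne · child (gen 1)
/--     item stmt-SmoothPoincare4-0378 · crux · RESIDUAL (gen 0; summit-strength until shown otherwise, D-0170) · rank 401 · open
    parent: CP2CancellationOne · by planner
    why it might fail: an exotic S⁴ all of whose handle decompositions need 1-handles; at b₂ = 0 no obstruction to removing 1-handles is known, but none to their necessity either (Kirby 4.18 open since 1978).
    sources: Kirby1997, arXiv:1103.1601
Kirby Problem 4.18 (for all closed simply connected 4-manifolds) specialised to homotopy spheres. No
obstruction known; 1-handle ↔ 3-handle trading needs an embedded-disc input. Sources: Kirby1997
4.18; GompfStipsicz1999 §5.1. -/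
@[route_item "route-SmoothPoincare4-RootDecompY"]
def NoOneHandlesExist : Prop :=
  ∀ S : Literature.Topology.FourManifolds.HomotopySphere 4, ∃ f : S.carrier → ℝ, Literature.Topology.FourManifolds.IsMorse (𝓡 4) f ∧ Literature.Topology.FourManifolds.criticalSetOfIndex (𝓡 4) f 1 = ∅

-- parent: CP2CancellationOne · child (gen 1)
/--     item stmt-SmoothPoincare4-32280 · crux · RESIDUAL (gen 0; summit-strength until shown otherwise, D-0170) · rank 403 · open
    parent: CP2CancellationOne · by planner
    why it might fail: An R-link sphere need not be standard even if it dissolves: unimax rows s ≥ 2 are balanced rank-(s+1) presentations of the trivial group with no known simplification (slides need not realise AC moves; Kirby 4.18/4.23 open), and no invariant separates an exotic GSC sphere from S⁴.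
    sources: arXiv:1103.1601, arXiv:1804.09169, arXiv:2403.10080, arXiv:1507.06561, arXiv:2604.17737, Kirby1997
[crux] UC = GscCP2Cancellation (NEW; DECLARED RESIDUAL of the split; species R = the residual is a
statement about EXPLICIT framed-link presentations, sampleable by census): for every n, every
n-component framed link L ⊂ S³ and every smooth 4-manifold M which is an R-link sphere on L (M ≅
trace of L ∪ 3/4-handles, i.e. a geometrically simply connected homotopy 4-sphere presented by L),
if M dissolves at rank one (some connected sum of M with ℂℙ² is diffeomorphic to ℂℙ²; the tree's
IsConnectedSum is orientation-free) then M ≅ S⁴. = X₁ ∩ (GSC standard): strictly weaker than both on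
paper; S-implied (kernel gscCP2Cancellation_of_summit); rows n = 0 (kernel, from ShallowDescentG's
witness S⁴ = Σ_∅), n = 1 (Gabai Property R, FloorOne.lean mod the tree's two Gabai/Kirby facts) and
n = 2 given TwoRLinkStandard #26031 (GST Prop 3.2) are decided; the extremal normal form (unimax
dissolving sphere = ribbon disc R ⊂ B⁴ ∪ core of the 2-handle of ℂℙ², ∂R = K unknotted in S³₊₁(U))
turns each dissolution into such a presentation with m = s + 1 (bridge trichotomy m − s + Mx = 2,
σ-symmetry), census instrument T-UNIMAX2. [lens-4 g9 «UnimaxNormalForm» NODE decomp-sp4/STATUS 844;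
critic decomp-sp4-cr -/
@[route_item "route-SmoothPoincare4-RootDecompY"]
def GscCP2Cancellation : Prop :=
  open scoped ContDiff in ∀ (n : ℕ) (L : Literature.Topology.FourManifolds.FramedLink (Fin n)) (M : Type) [TopologicalSpace M] [T2Space M] [SecondCountableTopology M] [ChartedSpace (EuclideanSpace ℝ (Fin 4)) M] [IsManifold (𝓡 4) ∞ M], Literature.Topology.FourManifolds.IsRLinkSphere M L → (∃ (P : Type) (_ : TopologicalSpace P) (_ : T2Space P) (_ : SecondCountableTopology P) (_ : ChartedSpace (EuclideanSpace ℝ (Fin 4)) P) (_ : IsManifold (𝓡 4) ∞ P), Literature.Topology.FourManifolds.IsConnectedSum (𝓡 4) (𝓡 4) (𝓡 4) M Literature.Topology.FourManifolds.ComplexProjectivePlane P ∧ Nonempty (P ≃ₘ⟮𝓡 4, 𝓡 4⟯ Literature.Topology.FourManifolds.ComplexProjectivePlane)) → Nonempty (M ≃ₘ⟮𝓡 4, 𝓡 4⟯ Metric.sphere (0 : EuclideanSpace ℝ (Fin 5)) 1)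

-- parent: CP2CancellationOne · child (gen 1)
/--     item stmt-SmoothPoincare4-25269 · support · rank 402 · open
    parent: CP2CancellationOne · by planner
    why it might fail: routine (Milnor Morse theory + handle cancellation bookkeeping); only the formalisation is long.
    sources: arXiv:1103.1601, Kirby1989, Milnor1965
[support] the Morse → handlebody bridge (lens W1; support, not a crux): a smooth homotopy 4-sphere
carrying a Morse function without index-1 critical points is an R-link sphere Σ_L for some framed
link L ⊂ S³ (handle decomposition from a generic Morse function, Milnor / GompfStipsicz1999 §4.2; no
1-handles ⇒ the 2-handles attach to B⁴ along a framed link whose trace has boundary #ⁿ S¹ × S², and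
the 3/4-handles form a (0;n·1)-handlebody by χ = 2 — GompfScharlemannThompson2010 §9). S-implied
trivially (S⁴ = Σ_∅: tree `isRLinkSphere_sphere_four_empty` + `IsRLinkSphere.of_diffeomorph`,
kernel-checked in the writer sketch). A textbook fact absent from the tree; provable by anyone idle
once `IsMorse`-to-handle-decomposition infrastructure exists. [difficulty: M] -/
@[route_item "route-SmoothPoincare4-RootDecompY"]
def MorseGscIsRLinkSphere : Prop :=
  ∀ S : Literature.Topology.FourManifolds.HomotopySphere 4, (∃ f : S.carrier → ℝ, Literature.Topology.FourManifolds.IsMorse (𝓡 4) f ∧ Literature.Topology.FourManifolds.criticalSetOfIndex (𝓡 4) f 1 = ∅) → ∃ (n : ℕ) (L : Literature.Topology.FourManifolds.FramedLink (Fin n)), Literature.Topology.FourManifolds.IsRLinkSphere S.carrier L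

-- parent: CP2CancellationOne · glue (gen 1)
/--     item stmt-SmoothPoincare4-32281 · support · rank 404 · closed · proved by Summit.SmoothPoincare4.SmoothPoincare4.Theorems.RootDecompYCP2CancellationOneGscSplit.cp2CancellationOneGscGlue_holds (prover)
    parent: CP2CancellationOne · GLUE: children ⟹ parent · by planner
NoOneHandlesExist → MorseGscIsRLinkSphere → GscCP2Cancellation → CP2CancellationOne -/
@[route_item "route-SmoothPoincare4-RootDecompY"]
def CP2CancellationOneGscGlue : Prop :=
  NoOneHandlesExist → MorseGscIsRLinkSphere → GscCP2Cancellation → CP2CancellationOne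

-- `CP2CancellationOneGscGlue` holds: proved by `Summit.SmoothPoincare4.SmoothPoincare4.Theorems.RootDecompYCP2CancellationOneGscSplit.cp2CancellationOneGscGlue_holds` (its module imports this route file, so no `_holds` link can be stated here).

/-- item stmt-SmoothPoincare4-30443 · assembly · rank 1 · open · by planner
sources: Kirby1989
[assembly] the deciding chain TSD → MD2 → X₁ → SmoothPoincare4 (kept for the schema; the deciding
theorem is `closes` in route/glue.lean; file `aside` if BC6 requires). -/
@[route_item "route-SmoothPoincare4-RootDecompY"]
def Assembly : Prop :=
  Summit.SmoothPoincare4.SmoothPoincare4.Theses.RootDecompY.TwoStepDissolution → Summit.SmoothPoincare4.SmoothPoincare4.Theses.RootDecompY.TwoStepDescent → Summit.SmoothPoincare4.SmoothPoincare4.Theses.RootDecompY.CP2CancellationOne → _root_.SmoothPoincare4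

/-! D-0027 §2.1 — DECIDING THEOREM (planner-authored via `route open/edit --closes-file`; by planner-decomp-sp4-writer-1-g3-0 2026-08-30T07:46:31Z):
its hypotheses are this route's items and its conclusion the sub-problem Statement (glue_lint), and it elaborates with this file. -/

-- Deciding theorem of the proposed root OR-sibling «TwistedCarving» (letter X advisory; W = lens-5 DivisorLadder, born 07:13Z): pure logic over the
-- route's three items (TwoStepDissolution NEW, TwoStepDescent NEW, CP2CancellationOne = #17708 verbatim).
-- Elaborates with the minimal import list [ConnectedSum, ComplexProjectiveSpace] (SigCheck.lean rc 0;
-- kernel v7/TwistedCarving.lean `closes`, axioms {propext, Classical.choice, Quot.sound}).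
@[closes "route-SmoothPoincare4-RootDecompY"] theorem closes (h₁ : TwoStepDissolution) (h₂ : TwoStepDescent) (h₃ : CP2CancellationOne) :
    _root_.SmoothPoincare4 := by
  intro M _ _ _ _ _ e
  exact h₃ M e (h₂ M e (h₁ M ⟨e⟩))

end Summit.SmoothPoincare4.SmoothPoincare4.Theses.RootDecompY
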